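import Mathlib
import HarnessLib

/-!
# `RationalShortRootRigidity` — Step 3 of the paper proof, part I: from the plane-rotation symmetry to the three
# coordinate Givens symmetries

Helper for crux `stmt-QuantumFields-23124` (`F4SubCurvatureDoor.RationalShortRootRigidity`, LINE g15-A of planner
ym-idea-3; paper proof HOME l15/RATIONAL-SHORT-ROOT-RIGIDITY.md, birth skeleton l15/RationalShortRootRigidity-birth.lean).
This is PART I of the skeleton's Step 3 (`stub_so4 : ∀ D₀, IsB4Inv D₀ → PlaneRotInv D₀ → Radial D₀`, hypotheses UNFOLDED
verbatim, the skeleton's `rotPlane` inlined); part II (`RationalShortRootRigidityRadialOfPlaneRotation.lean`) finishes with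
`radial_of_b4Inv_of_planeRotInv`.  Setting: `D ∈ ℝ[p₀,…,p₃]` invariant (as a function on `ℝ⁴`) under all signed coordinate
permutations and under the one-parameter group of rotations of the plane `span(e₀, (e₁+e₂+e₃)/√3)`.

Steps proved here (elementary; no Lie theory, no transitivity words):
1. Chain rule for `MvPolynomial.eval` along a differentiable curve (`hasDerivAt_eval_curve`, by `induction_on` and `pderiv`).
2. Conjugating the plane family by the sign patterns `ε ∈ {(+++), (+−−), (−+−), (−−+)}` of the spatial coordinates gives
   four more one-parameter symmetries; differentiating `φ ↦ D(R^ε_φ p) = D(p)` at `φ = 0` gives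
   `Σᵢ εᵢ (p₀ ∂ᵢD − pᵢ ∂₀D)(p) = 0`, and summing two patterns isolates each coordinate generator:
   `Λ₀ᵢ(p) := p₀ ∂ᵢD(p) − pᵢ ∂₀D(p) = 0` for `i = 1, 2, 3` (`gen_vanish`).
3. Integration: along the Givens family `θ ↦ G₀ᵢ(θ)p` the derivative of `D` is `Λ₀ᵢ(G₀ᵢ(θ)p) = 0`, so `D` is invariant
   under the three coordinate-plane rotation groups (`eval_givens`).
(Part II: three eliminations and the even univariate restriction.)

Mathlib only; THEOREMS ONLY (no definitions).  Nothing about the Yang–Mills mass gap is proved; the crux (which needs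
also Steps 1, 2, 4) stays open.  Free-hands width seat `ym-line-sfw-p2-w4` (cell ym-idea-1).
-/

set_option autoImplicit false

namespace Summit.QuantumFields.YangMills.Theorems.RationalShortRootRigidity

open MvPolynomial Finset
open scoped BigOperators Polynomial

/-! ## 1. Chain rule for `MvPolynomial.eval` along a curve -/

/-- `pderiv j (X i) = [j = i]`. [folklore] -/
theorem pderiv_X_eq_ite {n : ℕ} (i j : Fin n) :
    MvPolynomial.pderiv j (X i : MvPolynomial (Fin n) ℝ) = if j = i then 1 else 0 := by
  rw [MvPolynomial.pderiv_X]
  by_cases h : j = i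
  · subst h; simp
  · rw [if_neg h, Pi.single_eq_of_ne' h]

/-- Chain rule: `d/dt D(γ(t)) = Σᵢ (∂ᵢD)(γ(t))·γᵢ'(t)` for a polynomial `D` and a curve `γ` differentiable
coordinatewise at `t = θ`. [folklore] -/
theorem hasDerivAt_eval_curve {n : ℕ} (D : MvPolynomial (Fin n) ℝ) {γ : ℝ → Fin n → ℝ} {γ' : Fin n → ℝ}
    {θ : ℝ} (hγ : ∀ i, HasDerivAt (fun t => γ t i) (γ' i) θ) :
    HasDerivAt (fun t => MvPolynomial.eval (γ t) D)
      (∑ i, MvPolynomial.eval (γ θ) (MvPolynomial.pderiv i D) * γ' i) θ := by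
  induction D using MvPolynomial.induction_on with
  | C a =>
      simp only [MvPolynomial.eval_C, MvPolynomial.pderiv_C, map_zero, zero_mul, Finset.sum_const_zero]
      exact hasDerivAt_const θ a
  | add p q hp hq =>
      have hfun : (fun t => MvPolynomial.eval (γ t) (p + q)) =
          fun t => MvPolynomial.eval (γ t) p + MvPolynomial.eval (γ t) q := by
        funext t; simp only [map_add]
      rw [hfun]
      refine (hp.add hq).congr_deriv ?_
      simp only [map_add, add_mul, Finset.sum_add_distrib]
  | mul_X p i hp =>
      have hfun : (fun t => MvPolynomial.eval (γ t) (p * X i)) =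
          fun t => MvPolynomial.eval (γ t) p * γ t i := by
        funext t; simp only [map_mul, MvPolynomial.eval_X]
      rw [hfun]
      refine (hp.mul (hγ i)).congr_deriv ?_
      have hsplit : ∀ j : Fin n,
          MvPolynomial.eval (γ θ) (MvPolynomial.pderiv j (p * X i)) * γ' j =
            (MvPolynomial.eval (γ θ) (MvPolynomial.pderiv j p) * γ' j) * γ θ i +
              MvPolynomial.eval (γ θ) p * (if j = i then γ' j else 0) := by
        intro j
        rw [Derivation.leibniz, smul_eq_mul, smul_eq_mul, map_add, map_mul, map_mul, MvPolynomial.eval_X,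
          pderiv_X_eq_ite]
        by_cases hji : j = i
        · subst hji; rw [if_pos rfl, if_pos rfl, map_one]; ring
        · rw [if_neg hji, if_neg hji, map_zero]; ring
      symm
      simp only [hsplit, Finset.sum_add_distrib, ← Finset.sum_mul, ← Finset.mul_sum, Finset.sum_ite_eq',
        Finset.mem_univ, if_true]

/-- If `t ↦ D(γ(t))` is constant then its chain-rule derivative vanishes:
`Σᵢ (∂ᵢD)(γ(θ))·γᵢ'(θ) = 0`. [folklore] -/
theorem sum_pderiv_eq_zero_of_const {n : ℕ} (D : MvPolynomial (Fin n) ℝ) {γ : ℝ → Fin n → ℝ} {γ' : Fin n → ℝ}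
    {θ : ℝ} (hγ : ∀ i, HasDerivAt (fun t => γ t i) (γ' i) θ) (c : ℝ)
    (hconst : ∀ t, MvPolynomial.eval (γ t) D = c) :
    (∑ i, MvPolynomial.eval (γ θ) (MvPolynomial.pderiv i D) * γ' i) = 0 := by
  have h1 := hasDerivAt_eval_curve D hγ
  have h2 : HasDerivAt (fun t => MvPolynomial.eval (γ t) D) 0 θ := by
    have : (fun t => MvPolynomial.eval (γ t) D) = fun _ => c := funext hconst
    rw [this]
    exact hasDerivAt_const θ c
  exact h1.unique h2

/-! ## 2. The coordinate generators `Λ₀ᵢ = p₀∂ᵢ − pᵢ∂₀` annihilate `D` -/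

/-- The sign-conjugated plane rotation family: for a sign pattern `ε` (with `ε 0 = 1`) and angle `φ`, the map
`p ↦ ε ⊙ R_φ(ε ⊙ p)`; coordinate `0`. (Stated as the derivative of the coordinate curve at `φ = 0`.) [folklore] -/
theorem hasDerivAt_conjRot_zero (ε p : Fin 4 → ℝ) :
    HasDerivAt (fun φ : ℝ => ε 0 * (Real.cos φ * (ε 0 * p 0) -
        Real.sin φ * ((ε 1 * p 1 + ε 2 * p 2 + ε 3 * p 3) / Real.sqrt 3)))
      (ε 0 * (-((ε 1 * p 1 + ε 2 * p 2 + ε 3 * p 3) / Real.sqrt 3))) 0 := by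
  have h := (((Real.hasDerivAt_cos 0).mul_const (ε 0 * p 0)).sub
    ((Real.hasDerivAt_sin 0).mul_const ((ε 1 * p 1 + ε 2 * p 2 + ε 3 * p 3) / Real.sqrt 3))).const_mul (ε 0)
  refine h.congr_deriv ?_
  rw [Real.sin_zero, Real.cos_zero]
  ring

/-- Same family, coordinates `k ≠ 0`. [folklore] -/
theorem hasDerivAt_conjRot_succ (ε p : Fin 4 → ℝ) (k : Fin 4) :
    HasDerivAt (fun φ : ℝ => ε k * (ε k * p k + ((Real.sin φ * (ε 0 * p 0) +
        Real.cos φ * ((ε 1 * p 1 + ε 2 * p 2 + ε 3 * p 3) / Real.sqrt 3)) -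
          (ε 1 * p 1 + ε 2 * p 2 + ε 3 * p 3) / Real.sqrt 3) / Real.sqrt 3))
      (ε k * ((ε 0 * p 0) / Real.sqrt 3)) 0 := by
  have h := ((((Real.hasDerivAt_sin 0).mul_const (ε 0 * p 0)).add
    ((Real.hasDerivAt_cos 0).mul_const ((ε 1 * p 1 + ε 2 * p 2 + ε 3 * p 3) / Real.sqrt 3))).sub_const
      ((ε 1 * p 1 + ε 2 * p 2 + ε 3 * p 3) / Real.sqrt 3)).div_const (Real.sqrt 3)
  have h2 := (h.const_add (ε k * p k)).const_mul (ε k)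
  refine h2.congr_deriv ?_
  rw [Real.sin_zero, Real.cos_zero]
  ring

/-- For a sign pattern `ε` with `ε 0 = 1`, `εᵢ = ±1`, signed-permutation invariance plus plane-rotation invariance give
the linear relation `Σ_{i=1,2,3} εᵢ (p₀ ∂ᵢD − pᵢ ∂₀D)(p) = 0`. [folklore] -/
theorem signed_gen_vanish (D : MvPolynomial (Fin 4) ℝ)
    (hB4 : ∀ (σ : Equiv.Perm (Fin 4)) (ε : Fin 4 → ℝ), (∀ i, ε i = 1 ∨ ε i = -1) →
      ∀ p : Fin 4 → ℝ, MvPolynomial.eval (fun i => ε i * p (σ i)) D = MvPolynomial.eval p D)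
    (hrot : ∀ (φ : ℝ) (p : Fin 4 → ℝ), MvPolynomial.eval (fun i => if i = 0 then
        Real.cos φ * p 0 - Real.sin φ * ((p 1 + p 2 + p 3) / Real.sqrt 3)
      else p i + ((Real.sin φ * p 0 + Real.cos φ * ((p 1 + p 2 + p 3) / Real.sqrt 3)) -
        (p 1 + p 2 + p 3) / Real.sqrt 3) / Real.sqrt 3) D = MvPolynomial.eval p D)
    (ε : Fin 4 → ℝ) (hε : ∀ i, ε i = 1 ∨ ε i = -1) (hε0 : ε 0 = 1) (p : Fin 4 → ℝ) :
    ∑ i ∈ ({1, 2, 3} : Finset (Fin 4)), ε i * (p 0 * MvPolynomial.eval p (MvPolynomial.pderiv i D) -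
      p i * MvPolynomial.eval p (MvPolynomial.pderiv 0 D)) = 0 := by
  -- the conjugated family and its derivative at 0
  set γ : ℝ → Fin 4 → ℝ := fun φ k => ε k * (if k = 0 then
        Real.cos φ * (ε 0 * p 0) - Real.sin φ * ((ε 1 * p 1 + ε 2 * p 2 + ε 3 * p 3) / Real.sqrt 3)
      else ε k * p k + ((Real.sin φ * (ε 0 * p 0) +
        Real.cos φ * ((ε 1 * p 1 + ε 2 * p 2 + ε 3 * p 3) / Real.sqrt 3)) -
          (ε 1 * p 1 + ε 2 * p 2 + ε 3 * p 3) / Real.sqrt 3) / Real.sqrt 3) with hγ_def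
  set γ' : Fin 4 → ℝ := fun k => if k = 0 then ε 0 * (-((ε 1 * p 1 + ε 2 * p 2 + ε 3 * p 3) / Real.sqrt 3))
      else ε k * ((ε 0 * p 0) / Real.sqrt 3) with hγ'_def
  have hε2 : ∀ i, ε i * ε i = 1 := by
    intro i; rcases hε i with h | h <;> simp [h]
  have hderiv : ∀ k, HasDerivAt (fun t => γ t k) (γ' k) 0 := by
    intro k
    by_cases hk : k = 0
    · subst hk
      simp only [hγ_def, hγ'_def, if_true]
      exact hasDerivAt_conjRot_zero ε p
    · simp only [hγ_def, hγ'_def, if_neg hk]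
      exact hasDerivAt_conjRot_succ ε p k
  -- the family is a symmetry of `D`
  have hconst : ∀ t, MvPolynomial.eval (γ t) D = MvPolynomial.eval p D := by
    intro t
    have h1 := hB4 (Equiv.refl _) ε hε (fun k => if k = 0 then
        Real.cos t * (ε 0 * p 0) - Real.sin t * ((ε 1 * p 1 + ε 2 * p 2 + ε 3 * p 3) / Real.sqrt 3)
      else ε k * p k + ((Real.sin t * (ε 0 * p 0) +
        Real.cos t * ((ε 1 * p 1 + ε 2 * p 2 + ε 3 * p 3) / Real.sqrt 3)) -
          (ε 1 * p 1 + ε 2 * p 2 + ε 3 * p 3) / Real.sqrt 3) / Real.sqrt 3)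
    simp only [Equiv.refl_apply] at h1
    have h2 := hrot t (fun k => ε k * p k)
    have h3 := hB4 (Equiv.refl _) ε hε p
    simp only [Equiv.refl_apply] at h3
    -- `γ t` is literally the argument of `h1`
    have hγt : γ t = fun k => ε k * (if k = 0 then
        Real.cos t * (ε 0 * p 0) - Real.sin t * ((ε 1 * p 1 + ε 2 * p 2 + ε 3 * p 3) / Real.sqrt 3)
      else ε k * p k + ((Real.sin t * (ε 0 * p 0) +
        Real.cos t * ((ε 1 * p 1 + ε 2 * p 2 + ε 3 * p 3) / Real.sqrt 3)) -
          (ε 1 * p 1 + ε 2 * p 2 + ε 3 * p 3) / Real.sqrt 3) / Real.sqrt 3) := rfl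
    rw [hγt, h1]
    -- the rotation at the point `ε ⊙ p`
    have h2' : MvPolynomial.eval (fun k : Fin 4 => if k = 0 then
        Real.cos t * (ε 0 * p 0) - Real.sin t * ((ε 1 * p 1 + ε 2 * p 2 + ε 3 * p 3) / Real.sqrt 3)
      else ε k * p k + ((Real.sin t * (ε 0 * p 0) +
        Real.cos t * ((ε 1 * p 1 + ε 2 * p 2 + ε 3 * p 3) / Real.sqrt 3)) -
          (ε 1 * p 1 + ε 2 * p 2 + ε 3 * p 3) / Real.sqrt 3) / Real.sqrt 3) D =
        MvPolynomial.eval (fun k => ε k * p k) D := by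
      simpa using h2
    rw [h2', h3]
  have hsum := sum_pderiv_eq_zero_of_const D hderiv (MvPolynomial.eval p D) hconst
  -- `γ 0 = p`
  have hγ0 : γ 0 = p := by
    funext k
    simp only [hγ_def, Real.cos_zero, Real.sin_zero, one_mul, zero_mul, sub_zero, zero_add]
    by_cases hk : k = 0
    · subst hk; simp only [if_true, ← mul_assoc, hε2, one_mul]
    · simp only [if_neg hk, sub_self, zero_div, add_zero, ← mul_assoc, hε2, one_mul]
  rw [hγ0] at hsum
  -- read off the linear relation
  rw [Fin.sum_univ_four] at hsum
  simp only [hγ'_def, if_true, hε0, one_mul, show (1 : Fin 4) ≠ 0 by decide, show (2 : Fin 4) ≠ 0 by decide,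
    show (3 : Fin 4) ≠ 0 by decide, if_false] at hsum
  have hs3 : Real.sqrt 3 ≠ 0 := Real.sqrt_ne_zero'.mpr (by norm_num)
  rw [Finset.sum_insert (by decide), Finset.sum_insert (by decide), Finset.sum_singleton]
  field_simp at hsum
  linear_combination hsum

/-- The three coordinate generators vanish: `p₀ ∂ᵢD(p) = pᵢ ∂₀D(p)` for `i = 1, 2, 3` and every `p`. [folklore] -/
theorem gen_vanish (D : MvPolynomial (Fin 4) ℝ)
    (hB4 : ∀ (σ : Equiv.Perm (Fin 4)) (ε : Fin 4 → ℝ), (∀ i, ε i = 1 ∨ ε i = -1) →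
      ∀ p : Fin 4 → ℝ, MvPolynomial.eval (fun i => ε i * p (σ i)) D = MvPolynomial.eval p D)
    (hrot : ∀ (φ : ℝ) (p : Fin 4 → ℝ), MvPolynomial.eval (fun i => if i = 0 then
        Real.cos φ * p 0 - Real.sin φ * ((p 1 + p 2 + p 3) / Real.sqrt 3)
      else p i + ((Real.sin φ * p 0 + Real.cos φ * ((p 1 + p 2 + p 3) / Real.sqrt 3)) -
        (p 1 + p 2 + p 3) / Real.sqrt 3) / Real.sqrt 3) D = MvPolynomial.eval p D)
    (i : Fin 4) (hi : i ≠ 0) (p : Fin 4 → ℝ) :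
    p 0 * MvPolynomial.eval p (MvPolynomial.pderiv i D) = p i * MvPolynomial.eval p (MvPolynomial.pderiv 0 D) := by
  -- the four sign patterns
  have hall := signed_gen_vanish D hB4 hrot (fun _ => 1) (fun _ => Or.inl rfl) rfl p
  have h1 := signed_gen_vanish D hB4 hrot ![1, 1, -1, -1]
    (by intro j; fin_cases j <;> simp) rfl p
  have h2 := signed_gen_vanish D hB4 hrot ![1, -1, 1, -1]
    (by intro j; fin_cases j <;> simp) rfl p
  have h3 := signed_gen_vanish D hB4 hrot ![1, -1, -1, 1]
    (by intro j; fin_cases j <;> simp) rfl p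
  rw [Finset.sum_insert (by decide), Finset.sum_insert (by decide), Finset.sum_singleton] at hall h1 h2 h3
  simp only [Matrix.cons_val_zero, Matrix.cons_val_one, Matrix.head_cons, Matrix.cons_val_two, Matrix.tail_cons,
    Matrix.cons_val_three, one_mul, neg_mul] at hall h1 h2 h3
  have hΛ1 : p 0 * MvPolynomial.eval p (MvPolynomial.pderiv 1 D) = p 1 * MvPolynomial.eval p (MvPolynomial.pderiv 0 D) := by
    linear_combination (hall + h1) / 2
  have hΛ2 : p 0 * MvPolynomial.eval p (MvPolynomial.pderiv 2 D) = p 2 * MvPolynomial.eval p (MvPolynomial.pderiv 0 D) := by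
    linear_combination (hall + h2) / 2
  have hΛ3 : p 0 * MvPolynomial.eval p (MvPolynomial.pderiv 3 D) = p 3 * MvPolynomial.eval p (MvPolynomial.pderiv 0 D) := by
    linear_combination (hall + h3) / 2
  have hi' : i = 1 ∨ i = 2 ∨ i = 3 := by
    fin_cases i <;> simp at hi ⊢
  rcases hi' with rfl | rfl | rfl
  · exact hΛ1
  · exact hΛ2
  · exact hΛ3

/-! ## 3. Integration: invariance under the three coordinate Givens families -/

/-- `D` is invariant under the Givens rotations of the coordinate plane `(0, i)`, `i ≠ 0`:
`D(…, cos θ·p₀ − sin θ·pᵢ, …, sin θ·p₀ + cos θ·pᵢ, …) = D(p)`. [folklore] -/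
theorem eval_givens (D : MvPolynomial (Fin 4) ℝ)
    (hB4 : ∀ (σ : Equiv.Perm (Fin 4)) (ε : Fin 4 → ℝ), (∀ i, ε i = 1 ∨ ε i = -1) →
      ∀ p : Fin 4 → ℝ, MvPolynomial.eval (fun i => ε i * p (σ i)) D = MvPolynomial.eval p D)
    (hrot : ∀ (φ : ℝ) (p : Fin 4 → ℝ), MvPolynomial.eval (fun i => if i = 0 then
        Real.cos φ * p 0 - Real.sin φ * ((p 1 + p 2 + p 3) / Real.sqrt 3)
      else p i + ((Real.sin φ * p 0 + Real.cos φ * ((p 1 + p 2 + p 3) / Real.sqrt 3)) -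
        (p 1 + p 2 + p 3) / Real.sqrt 3) / Real.sqrt 3) D = MvPolynomial.eval p D)
    (i : Fin 4) (hi : i ≠ 0) (p : Fin 4 → ℝ) (θ : ℝ) :
    MvPolynomial.eval (fun k => if k = 0 then Real.cos θ * p 0 - Real.sin θ * p i
      else if k = i then Real.sin θ * p 0 + Real.cos θ * p i else p k) D = MvPolynomial.eval p D := by
  set f : ℝ → ℝ := fun t => MvPolynomial.eval (fun k => if k = 0 then Real.cos t * p 0 - Real.sin t * p i
      else if k = i then Real.sin t * p 0 + Real.cos t * p i else p k) D with hf
  -- derivative of the Givens curve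
  have hderiv : ∀ t, HasDerivAt f 0 t := by
    intro t
    set γ : ℝ → Fin 4 → ℝ := fun t k => if k = 0 then Real.cos t * p 0 - Real.sin t * p i
      else if k = i then Real.sin t * p 0 + Real.cos t * p i else p k with hγ
    set γ' : Fin 4 → ℝ := fun k => if k = 0 then -(Real.sin t * p 0 + Real.cos t * p i)
      else if k = i then Real.cos t * p 0 - Real.sin t * p i else 0 with hγ'
    have hγd : ∀ k, HasDerivAt (fun s => γ s k) (γ' k) t := by
      intro k
      by_cases hk0 : k = 0
      · subst hk0
        have h := ((Real.hasDerivAt_cos t).mul_const (p 0)).sub ((Real.hasDerivAt_sin t).mul_const (p i))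
        have h' : HasDerivAt (fun s => Real.cos s * p 0 - Real.sin s * p i)
            (-(Real.sin t * p 0 + Real.cos t * p i)) t := h.congr_deriv (by ring)
        simpa [hγ, hγ'] using h'
      · by_cases hki : k = i
        · subst hki
          have h := ((Real.hasDerivAt_sin t).mul_const (p 0)).add ((Real.hasDerivAt_cos t).mul_const (p k))
          have h' : HasDerivAt (fun s => Real.sin s * p 0 + Real.cos s * p k)
              (Real.cos t * p 0 - Real.sin t * p k) t := h.congr_deriv (by ring)
          simpa [hγ, hγ', hk0] using h'
        · simp only [hγ, hγ', if_neg hk0, if_neg hki]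
          exact hasDerivAt_const t (p k)
    have h := hasDerivAt_eval_curve D hγd
    have hzero : (∑ k, MvPolynomial.eval (γ t) (MvPolynomial.pderiv k D) * γ' k) = 0 := by
      rw [Fintype.sum_eq_add 0 i (Ne.symm hi) (fun k hk => by simp [hγ', hk.1, hk.2])]
      have hg := gen_vanish D hB4 hrot i hi (γ t)
      have hq0 : γ t 0 = Real.cos t * p 0 - Real.sin t * p i := by simp [hγ]
      have hqi : γ t i = Real.sin t * p 0 + Real.cos t * p i := by simp [hγ, hi]
      have hγ'0 : γ' 0 = -(Real.sin t * p 0 + Real.cos t * p i) := by simp [hγ']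
      have hγ'i : γ' i = Real.cos t * p 0 - Real.sin t * p i := by simp [hγ', hi]
      rw [hγ'0, hγ'i, ← hq0, ← hqi]
      linear_combination hg
    rw [hzero] at h
    exact h
  have hdiff : Differentiable ℝ f := fun t => (hderiv t).differentiableAt
  have hconst := is_const_of_deriv_eq_zero hdiff (fun t => (hderiv t).deriv) θ 0
  have hp0 : (fun k : Fin 4 => if k = 0 then Real.cos 0 * p 0 - Real.sin 0 * p i
      else if k = i then Real.sin 0 * p 0 + Real.cos 0 * p i else p k) = p := by
    funext k
    by_cases hk0 : k = 0
    · subst hk0; simp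
    · by_cases hki : k = i
      · subst hki; simp [hk0]
      · simp [hk0, hki]
  have hf0 : f 0 = MvPolynomial.eval p D := by
    show MvPolynomial.eval (fun k : Fin 4 => if k = 0 then Real.cos 0 * p 0 - Real.sin 0 * p i
      else if k = i then Real.sin 0 * p 0 + Real.cos 0 * p i else p k) D = MvPolynomial.eval p D
    rw [hp0]
  rw [← hf0, ← hconst]


end Summit.QuantumFields.YangMills.Theorems.RationalShortRootRigidity
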